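import Mathlib
import HarnessLib

/-!
# Weil-type family coverage — THEOREM Λ_N: the product-action window for every number of branch points and every base genus (ring2-b02, gen 70)

research route conditional on HC_CM; not a corollary; Q11.4-sentence-2 already refuted in dim ≥ 3.

Ring 2, WEIL-TYPE FAMILY-COVERAGE CENSUS (`HOME/WEIL-FAMILY-COVERAGE.md` `## b02 (g = 6)`, block b02.30, owner ring2-b02).
Blocks b02.28–b02.29 (THEOREMS Z, P–P‴, LEMMA Ψ, THEOREM Λ, THEOREM Λ∞) closed the product-action window
`G₂ ≤ S_a × S_b`, `V = St_a ⊠ St_b`, of the six carriers `GL₂(3)`, `SD₁₆`, `PSL₂(7)`, `F₂₁`, `G₂₄`, `PSL₂(11)` on the ten residual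
sixfold rows for genus-0 data with `N ∈ {3,4,5}` branch classes, by per-signature certificates of THEOREM Λ; THEOREM Λ∞ bounded the
smaller side for `N ≥ 5` and for bases of genus `≥ 1`, but not the partner.  Block b02.30 finishes the window for EVERY `N` and EVERY base
genus with two remarks, whose arithmetic is checked here:

* **Worst class.**  With `χ = 2g₀ − 2 + N` in place of `N − 2`, THEOREM Λ's test at a corner reads
  `Σ_j t_j + λ(χ + 2ι_a) + μ(χ + 2ι_b) < χ·f·(1 − ι_a − ι_b) − 6ι_aι_b` (`ι = 1/side`, `0` at an infinite corner).  Every slot supremum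
  is at most `t* :=` the maximum of the suprema over ALL non-trivial classes of `G₁`, so the signature-free test
  `(T_{N,χ})  N·t* + λ(χ + 2ι_a) + μ(χ + 2ι_b) < χ f (1 − ι_a − ι_b) − 6ι_aι_b` excludes the bidegree for every signature with `N`
  non-trivial slots (`worst_class_dominates`); in normalised form `N·t* + E < χ·δ` with `E = 2λι_a + 2μι_b + 6ι_aι_b ≥ 0`,
  `δ = f(1 − ι_a − ι_b) − λ − μ` (`test_iff`).
* **Monotonicity in `N`.**  `(T_{6,4})` and `t* ≥ 0` give `(T_{N,χ})` for every `N ≥ 6`, `χ ≥ N − 2` — all base genera (`all_N_from_six`);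
  `(T_{1,1})` gives `(T_{N,χ})` for every `1 ≤ N ≤ χ` — every base of genus `≥ 1` (`all_N_from_one`).  So ONE worst-class closure table per
  carrier and mode bounds both sides of every datum with `N ≥ 6` non-trivial branch classes, resp. over every base of positive genus.
* **Pure `G₂`-points are free.**  A branch point with trivial `G₁`-class contributes `f·(dim V^{y} − 1)` to the master sum and its share of
  the Riemann–Hurwitz allowances; moving it to the budget side leaves the test of the NON-trivial sub-signature plus a defect
  `D = f·codim V^{y} − λ·b·e(σ) − μ·a·e(τ)`, and `D ≥ 0` whenever `λ + μ ≤ f(1 − 1/a − 1/b)` — which every passing certificate satisfies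
  (`pure_point_cost`, with `codim V^{y} = Σ_{C,C′}(ℓℓ′ − gcd(ℓ,ℓ′)) − e(σ) − e(τ)`, `codim_bookkeeping`, and the per-pair bound
  `ℓℓ′ − gcd ≥ (ℓ−1)ℓ′`, `pair_excess_ge`).  Hence every table of blocks b02.28–b02.30 holds with any number of additional pure
  `G₂`-branch points.
* §4 records the asymptotic corners `(∞,∞)` of the twelve certificates (machine output `weilcov/g70/prod/closureN_*.json`): at
  `N = 6, χ = 4` the worst classes are the involutions (`GL₂(3)`/`SD₁₆`: `t* = 171/256` at `λ = μ = 85/256`; `G₂₄`: `t* = 1` at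
  `λ = μ = 1/2`; `PSL₂(7)`: `3/2`; `F₂₁`: `1`; `PSL₂(11)`: `683/256` at `λ = 21/256, μ = 1/4`), and `6t* + 4(λ+μ) < 4f` in each case.

The certificates themselves (pairs `lcm ≤ 420`, tail `(f−λ−μ)⁺/421`, exact rationals, four corners per region) are machine output of
`weilcov/g70/prod/psiN.py` over gen 69's `psi.py`; this file checks the inequalities they are assembled from and the two induction steps.
Nothing in this file is a statement about Hodge classes; `HC_CM` is used nowhere; no `def`, no named fact.
References: [cite: vanGeemen1994HodgeAV, 5.2 and (5.4.1)] (the Weil-type hidden factor and its hermitian form);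
Chevalley–Weil multiplicity formula [cite: Serre1973, Ch. III §1] as used in b02.21 / b02.28 / b02.29.
-/

set_option linter.dupNamespace false

namespace Summit.HodgeConjecture.HodgeConjecture.Ring2.WeilCoverage

namespace AllBranchCounts

/-! ### §1 The signature-free test -/

/-- **Worst class dominates.**  If the slot sum is at most `N·t*` (every slot supremum is bounded by the maximum over all non-trivial
classes) and the signature-free test `N·t* + R < C` holds, then THEOREM Λ's test `Σ_j t_j + R < C` holds for the signature.
research route conditional on HC_CM; not a corollary; Q11.4-sentence-2 already refuted in dim ≥ 3. [folklore] -/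
theorem worst_class_dominates {s N t R C : ℚ} (hs : s ≤ N * t) (htest : N * t + R < C) : s + R < C := by
  linarith

/-- **Normalised form of the test.**  With `E = 2λι_a + 2μι_b + 6ι_aι_b` and `δ = f(1 − ι_a − ι_b) − λ − μ`:
`N t + λ(χ + 2ι_a) + μ(χ + 2ι_b) < χ f (1 − ι_a − ι_b) − 6 ι_a ι_b  ↔  N t + E < χ δ`.
research route conditional on HC_CM; not a corollary; Q11.4-sentence-2 already refuted in dim ≥ 3. [folklore] -/
theorem test_iff (N t lam mu chi f ia ib : ℚ) :
    N * t + lam * (chi + 2 * ia) + mu * (chi + 2 * ib) < chi * f * (1 - ia - ib) - 6 * ia * ib ↔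
      N * t + (2 * lam * ia + 2 * mu * ib + 6 * ia * ib) < chi * (f * (1 - ia - ib) - lam - mu) := by
  constructor <;> intro h <;> linarith

/-- The error term `E = 2λι_a + 2μι_b + 6ι_aι_b` is non-negative for non-negative multipliers and inverse sides.
research route conditional on HC_CM; not a corollary; Q11.4-sentence-2 already refuted in dim ≥ 3. [folklore] -/
theorem error_term_nonneg {lam mu ia ib : ℚ} (hlam : 0 ≤ lam) (hmu : 0 ≤ mu) (hia : 0 ≤ ia) (hib : 0 ≤ ib) :
    0 ≤ 2 * lam * ia + 2 * mu * ib + 6 * ia * ib := by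
  positivity

/-! ### §2 Monotonicity in the number of branch classes -/

/-- From the genus-0 test with six non-trivial slots, `6t* + E < 4δ`, and `t* ≥ 0`, `E ≥ 0`: the gap `δ` is positive and exceeds `t*`.
research route conditional on HC_CM; not a corollary; Q11.4-sentence-2 already refuted in dim ≥ 3. [folklore] -/
theorem delta_pos_of_test_six {t E δ : ℚ} (ht : 0 ≤ t) (hE : 0 ≤ E) (h6 : 6 * t + E < 4 * δ) : 0 < δ ∧ t < δ := by
  constructor <;> linarith

/-- **THEOREM Λ_N (i): all `N ≥ 6`, all base genera.**  If `(T_{6,4})` holds in normalised form, `6t* + E < 4δ`, with `t*, E ≥ 0`,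
then `N t* + E < χ δ` for every `N ≥ 6` and every `χ ≥ N − 2` (`χ = 2g₀ − 2 + N ≥ N − 2` for every base genus `g₀ ≥ 0`).
Proof: `N t* + E = 6t* + E + (N − 6)t* < 4δ + (N − 6)δ = (N − 2)δ ≤ χδ`.
research route conditional on HC_CM; not a corollary; Q11.4-sentence-2 already refuted in dim ≥ 3. [folklore] -/
theorem all_N_from_six {t E δ N chi : ℚ} (ht : 0 ≤ t) (hE : 0 ≤ E) (h6 : 6 * t + E < 4 * δ) (hN : 6 ≤ N)
    (hchi : N - 2 ≤ chi) : N * t + E < chi * δ := by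
  have hδ : 0 < δ := by linarith
  have htδ : t ≤ δ := by linarith
  have h1 : (N - 6) * t ≤ (N - 6) * δ := mul_le_mul_of_nonneg_left htδ (by linarith)
  have h2 : (N - 2) * δ ≤ chi * δ := mul_le_mul_of_nonneg_right hchi hδ.le
  have h3 : N * t + E = 6 * t + E + (N - 6) * t := by ring
  nlinarith

/-- **THEOREM Λ_N (ii): every base of positive genus.**  If `(T_{1,1})` holds in normalised form, `t* + E < δ`, with `t*, E ≥ 0`, then
`N t* + E < χ δ` for every `1 ≤ N ≤ χ` (`χ = 2g₀ − 2 + N ≥ N` for `g₀ ≥ 1`).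
Proof: `N t* + E ≤ N(t* + E) < Nδ ≤ χδ`.
research route conditional on HC_CM; not a corollary; Q11.4-sentence-2 already refuted in dim ≥ 3. [folklore] -/
theorem all_N_from_one {t E δ N chi : ℚ} (ht : 0 ≤ t) (hE : 0 ≤ E) (h1 : t + E < δ) (hN : 1 ≤ N) (hchi : N ≤ chi) :
    N * t + E < chi * δ := by
  have hδ : 0 < δ := by linarith
  have hNE : E ≤ N * E := le_mul_of_one_le_left hE hN
  have h2 : N * (t + E) < N * δ := mul_lt_mul_of_pos_left h1 (by linarith)
  have h3 : N * δ ≤ chi * δ := mul_le_mul_of_nonneg_right hchi hδ.le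
  nlinarith

/-- Unramified data over a base of genus `g₀ ≥ 2` (`N = 0`, `χ = 2g₀ − 2 ≥ 2`) never carry a sixfold window: with `λ = μ = 0` the test is
`6/(ab) < χ f (1 − 1/a − 1/b)`, true for `a, b ≥ 3`, `f ≥ 2`, `χ ≥ 2` (here with `ι_a, ι_b ≤ 1/3`).
research route conditional on HC_CM; not a corollary; Q11.4-sentence-2 already refuted in dim ≥ 3. [folklore] -/
theorem etale_excluded {f chi ia ib : ℚ} (hf : 2 ≤ f) (hchi : 2 ≤ chi) (hia : 0 ≤ ia) (hia' : ia ≤ 1 / 3) (hib : 0 ≤ ib)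
    (hib' : ib ≤ 1 / 3) : 6 * ia * ib < chi * f * (1 - ia - ib) := by
  have h0 : ia * ib ≤ 1 / 3 * ib := mul_le_mul_of_nonneg_right hia' hib
  have h1 : 6 * ia * ib ≤ 2 / 3 := by nlinarith
  have h2 : (1 : ℚ) / 3 ≤ 1 - ia - ib := by linarith
  have h3 : (4 : ℚ) ≤ chi * f := by nlinarith
  nlinarith

/-! ### §3 Pure `G₂`-branch points cost nothing to exclude -/

/-- At the pair `(1,1)` the trivial class (`ψ(1) = f`) has `h = f(1 − ι_a − ι_b) − λ − μ`; adding `λ + μ` (its Riemann–Hurwitz allowance)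
gives exactly the budget share `f(1 − ι_a − ι_b)` of one branch point: in THEOREM Λ's relaxation a pure `G₂`-point is neutral, so it has to
be charged by the exact accounting of `pure_point_cost` instead.
research route conditional on HC_CM; not a corollary; Q11.4-sentence-2 already refuted in dim ≥ 3. [folklore] -/
theorem trivial_slot_increment (f ia ib lam mu : ℚ) :
    (f - f * ib - f * ia - lam - mu) + (lam + mu) = f * (1 - ia - ib) := by
  ring

/-- Per pair of cycles (`|C| = ℓ`, `|C′| = ℓ′ ≥ 1`): `ℓℓ′ − gcd(ℓ,ℓ′) ≥ (ℓ − 1)ℓ′`, since `gcd(ℓ,ℓ′) ≤ ℓ′`.  Summing over the cycles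
`C′` of `τ` (`Σ ℓ′ = b`) and then over `C`: `Σ_{C,C′}(ℓℓ′ − gcd) ≥ b·e(σ)` with `e(σ) = a − cyc σ`; symmetrically `≥ a·e(τ)`.
research route conditional on HC_CM; not a corollary; Q11.4-sentence-2 already refuted in dim ≥ 3. [folklore] -/
theorem pair_excess_ge (l l' : ℕ) (hl' : 0 < l') : ((l : ℚ) - 1) * l' ≤ (l : ℚ) * l' - (Nat.gcd l l' : ℚ) := by
  have h : (Nat.gcd l l' : ℚ) ≤ (l' : ℚ) := by exact_mod_cast Nat.le_of_dvd hl' (Nat.gcd_dvd_right l l')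
  linarith

/-- **Codimension bookkeeping.**  On `ℚ^{[a]×[b]} = 1 ⊕ St_a ⊕ St_b ⊕ V` the `⟨y⟩`-invariants have dimension the number of orbits
`orb = Σ_{C,C′} gcd(ℓ,ℓ′)` (LEMMA Ψ), so `dim V^{y} = orb − cyc σ − cyc τ + 1`; with `Σ_{C,C′} ℓℓ′ = ab` and `v = (a−1)(b−1)`:
`codim V^{y} = Σ_{C,C′}(ℓℓ′ − gcd) − e(σ) − e(τ)`.
research route conditional on HC_CM; not a corollary; Q11.4-sentence-2 already refuted in dim ≥ 3. [folklore] -/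
theorem codim_bookkeeping {a b cs ct orb sumll dimV : ℚ} (hdim : dimV = orb - cs - ct + 1) (hsum : sumll = a * b) :
    (a - 1) * (b - 1) - dimV = (sumll - orb) - (a - cs) - (b - ct) := by
  rw [hdim, hsum]
  ring

/-- **Pure-point cost.**  For a branch point with trivial `G₁`-class and `y = (σ,τ)`: write `x = b·e(σ)`, `y = a·e(τ)`,
`M = Σ_{C,C′}(ℓℓ′ − gcd) ≥ max(x, y)` (`pair_excess_ge`), `ι_a = 1/a`, `ι_b = 1/b`, so that `f·codim V^{y} = f(M − ι_b x − ι_a y)`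
(`codim_bookkeeping`) and the Riemann–Hurwitz charges are `λ b e(σ) + μ a e(τ) = λx + μy`.  If `λ + μ ≤ f(1 − ι_a − ι_b)` — true for
every passing certificate of THEOREM Λ — then the defect `f·codim V^{y} − λx − μy` is non-negative: the exact master identity with the
pure points moved to the budget side is at least as demanding as the test of the non-trivial sub-signature.
research route conditional on HC_CM; not a corollary; Q11.4-sentence-2 already refuted in dim ≥ 3. [folklore] -/
theorem pure_point_cost {f lam mu ia ib x y M : ℚ} (hf : 0 ≤ f) (hlam : 0 ≤ lam) (hmu : 0 ≤ mu) (hia : 0 ≤ ia) (hib : 0 ≤ ib)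
    (hsum : lam + mu ≤ f * (1 - ia - ib)) (hx : 0 ≤ x) (hxM : x ≤ M) (hyM : y ≤ M) :
    lam * x + mu * y ≤ f * (M - ib * x - ia * y) := by
  have hM : 0 ≤ M := le_trans hx hxM
  have c1 : 0 ≤ lam + f * ib := by positivity
  have c2 : 0 ≤ mu + f * ia := by positivity
  have h1 : x * (lam + f * ib) ≤ M * (lam + f * ib) := mul_le_mul_of_nonneg_right hxM c1
  have h2 : y * (mu + f * ia) ≤ M * (mu + f * ia) := mul_le_mul_of_nonneg_right hyM c2
  have h3 : M * (lam + mu) ≤ M * (f * (1 - ia - ib)) := mul_le_mul_of_nonneg_left hsum hM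
  nlinarith

/-- A passing test forces `λ + μ < f(1 − ι_a − ι_b)`: from `N t* + E < χδ` with `N t*, E ≥ 0` and `χ > 0`, `δ > 0`.  So the hypothesis
of `pure_point_cost` is automatic at every certified corner (and a fortiori inside the certified region, where `1 − 1/a − 1/b` is larger).
research route conditional on HC_CM; not a corollary; Q11.4-sentence-2 already refuted in dim ≥ 3. [folklore] -/
theorem multipliers_lt_of_test {Nt E chi f ia ib lam mu : ℚ} (hNt : 0 ≤ Nt) (hE : 0 ≤ E) (hchi : 0 < chi)
    (htest : Nt + E < chi * (f * (1 - ia - ib) - lam - mu)) : lam + mu < f * (1 - ia - ib) := by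
  have h : 0 < chi * (f * (1 - ia - ib) - lam - mu) := by linarith
  rcases le_or_gt (f * (1 - ia - ib) - lam - mu) 0 with hle | hpos
  · have : chi * (f * (1 - ia - ib) - lam - mu) ≤ 0 := mul_nonpos_of_nonneg_of_nonpos hchi.le hle
    linarith
  · linarith

/-! ### §4 The asymptotic corners of the twelve certificates (`N = 6, χ = 4` and `N = χ = 1`, corner `(∞,∞)`) -/

/-- `GL₂(3)` and `SD₁₆` (`f = 2`), `N = 6`, `χ = 4`, `λ = μ = 85/256`: the worst class is a non-central involution at the pair `(2,2)`,
`t* = (2 − λ − μ)/2 = 171/256`, and `6t* + 4(λ + μ) = 1706/256 < 8 = 4f`.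
research route conditional on HC_CM; not a corollary; Q11.4-sentence-2 already refuted in dim ≥ 3. [folklore] -/
theorem gl23_six_corner_inf :
    ((2 : ℚ) - 85/256 - 85/256) / 2 = 171/256 ∧ 6 * (171/256 : ℚ) + 4 * (85/256 + 85/256) < 4 * 2 := by
  norm_num

/-- `G₂₄` (`f = 3`), `N = 6`, `χ = 4`, `λ = μ = 1/2`: worst class `−1` (exponents `½,½,½`, `ψ(2) = 3/2`) at the pair `(2,2)`,
`t* = 3/2 − 1/4 − 1/4 = 1`, and `6·1 + 4·1 = 10 < 12 = 4f`.
research route conditional on HC_CM; not a corollary; Q11.4-sentence-2 already refuted in dim ≥ 3. [folklore] -/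
theorem g24_six_corner_inf : (3 : ℚ)/2 - (1/2)/2 - (1/2)/2 = 1 ∧ 6 * (1 : ℚ) + 4 * (1/2 + 1/2) < 4 * 3 := by
  norm_num

/-- `PSL₂(7)` (`λ = μ = 0`, worst class `2A`, `ψ(2) = 3/2`: `6·(3/2) < 12`), `F₂₁` (worst class `3a`, `t* = 1`: `6 < 12`) and
`PSL₂(11)` (`f = 5`, `λ = 21/256`, `μ = 1/4`, worst class `2A` at the pair `(1,1)`, `φ = 3`: `t* = 3 − 85/256 = 683/256`,
`6t* + 4·85/256 = 4438/256 < 20 = 4f`) at `N = 6`, `χ = 4`, corner `(∞,∞)`.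
research route conditional on HC_CM; not a corollary; Q11.4-sentence-2 already refuted in dim ≥ 3. [folklore] -/
theorem f3_f5_six_corner_inf :
    6 * ((3 : ℚ)/2) < 4 * 3 ∧ 6 * (1 : ℚ) < 4 * 3 ∧
      (3 : ℚ) - 21/256 - 1/4 = 683/256 ∧ 6 * (683/256 : ℚ) + 4 * (21/256 + 1/4) < 4 * 5 := by
  norm_num

/-- Mode `N = χ = 1` (bases of positive genus), corner `(∞,∞)`, `λ = μ = 0`: the worst classes are the reflections / `2A` at the pair
`(1,1)` with `t* = φ_max` (`GL₂(3)`/`SD₁₆`: `1 < 2`; `PSL₂(7)`: `3/2 < 3` (pair `(1,2)`); `G₂₄`: `2 < 3`; `F₂₁`: `1 < 3`; `PSL₂(11)`: `3 < 5`):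
`t* < f` in every case, i.e. `(T_{1,1})` holds at infinity.
research route conditional on HC_CM; not a corollary; Q11.4-sentence-2 already refuted in dim ≥ 3. [folklore] -/
theorem one_corner_inf :
    (1 : ℚ) < 2 ∧ (3 : ℚ)/2 < 3 ∧ (2 : ℚ) < 3 ∧ (1 : ℚ) < 3 ∧ (3 : ℚ) < 5 := by
  norm_num

end AllBranchCounts

end Summit.HodgeConjecture.HodgeConjecture.Ring2.WeilCoverage
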